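import Summits.ResolutionOfSingularities.ResolutionOfSingularities.Theorems.FrobeniusClosingSteerNoSatelliteStepTwoBasisParts
import Summits.ResolutionOfSingularities.ResolutionOfSingularities.Theorems.FrobeniusClosingSteerNoSatelliteStepSupport
import Summits.ResolutionOfSingularities.ResolutionOfSingularities.Theorems.FrobeniusClosingSteerRadicandNonIsolatedOfOddSupport
import HarnessLib

/-!
# Crux `Steer` (stmt-ResolutionOfSingularities-16345), chain W4.1, hGW3 piece (S_λ): the λ-twisted SUPPORT KILL (Σ_λ) and the non-isolatedness
# criterion (N_λ) in `K⟦x, y, z_k⟧` over a field with a finite 2-basis (replaces the perfect-field stages (Σ)+(N) of Lemma S)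

OURS (campaign `res-hironaka`, rung L ★L-G4, slot W4.1; seat res-L0-w41-stub-3 g8, res-L0-w41-plan-1 RULING 251 (c); spec = res-L0-w41-stub-2's `hGW3-ASSEMBLY-MAP.md`
d0970ee959ebaf4a §2 (S_λ) over res-D-lib-1's K-GG1 (`…TwoBasisDecompositionA` / `…TwoBasisSubstitution`), res-L0-w41-stub-2's κ-free (Σ) `NoSatelliteSupport.odd_support_of_window`
(p547869) and res-D-pv-007's (CD0) `NoSatelliteStep.not_hasIsolatedSingularity_of_sub_pow_mem_sq_span_abstract`; replaces the role of no printed item; NOT a statement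
of the manuscript under review [claim: Hironaka2017, status: under-review]; AI-produced, weaker than expert review). Theses-free, definition-free. Letters `σ = Fin (m+2)`:
`0 ↔ x`, `1 ↔ y` (the satellite letter), `k+2 ↔ z_k`.

ARGUMENT. Write `F = ∑_ε λ^ε (S_ε)² + O` (K-GG1). The realisability `x^(2e)·F = H(x, xy, xz)` and the satellite reading `F(x′y, y, wy) = A² + y^(2e)·R`, `R ∈ 𝔪^(2e)`,
pass to the components (`…TwoBasisParts`): `x^e·S_ε = (sqPart H ε)(x, xy, xz)` and, for `ε ≠ 0`, `S_ε(x′y, y, wy) = y^e · sqPart R ε` with `sqPart R ε ∈ 𝔪^e`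
coefficientwise. A pure power `y^b` in `S_ε` would need `b ≤ e` (realisability) and `b ≥ 2e` (reading) — impossible for `e ≥ 1`; so every `S_ε`, `ε ≠ 0`, lies in
`(X_t : t ≠ y)`, while `O ∈ (X_t : t ≠ y)²` by (Σ). Hence `F − S_0² ∈ (X_t : t ≠ y)²` with `m + 1 < m + 2` letters, and (CD0) applies.

* `NoSatelliteStepTwoBasis.sqPart_support_of_window` — **(Σ_λ)**: every monomial of `sqPart F ε`, `ε ≠ 0`, has `Σ_{t ≠ y} ≥ 1`;
* `NoSatelliteStepTwoBasis.not_hasIsolatedSingularity_of_twoBasis_support` — **(N_λ)**: odd part of `T`-degree `≥ 2`, non-trivial square parts of `T`-degree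
  `≥ 1`, `#T < #σ` ⟹ the `2`-radicand of `F` is NOT isolated;
* `NoSatelliteStepTwoBasis.eq_sq_add_of_map_ringEquiv` — undo the residue isomorphism `ρ` on the reading (γ);
* `NoSatelliteStepTwoBasis.not_hasIsolatedSingularity_of_window_twoBasis` — **the package** consumed by the one-window theorem (S_λ). [folklore]
-/

noncomputable section

set_option linter.dupNamespace false

open MvPowerSeries IsLocalRing
open Literature.AlgebraicGeometry.Resolution Literature.RingTheory.MvPowerSeries Literature.RingTheory.MvPowerSeries.monoidPowerSeries
open Summit.ResolutionOfSingularities.ResolutionOfSingularities.Theorems.SwitchingDichotomy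
open Summit.ResolutionOfSingularities.ResolutionOfSingularities.Theorems.SwitchingDichotomy.SigmaTopLegality
open Summit.ResolutionOfSingularities.ResolutionOfSingularities.Theorems.SwitchingDichotomy.ChartMonomialSubst
open Summit.ResolutionOfSingularities.ResolutionOfSingularities.Theorems.SwitchingDichotomy.TwoBasis

namespace Summit.ResolutionOfSingularities.ResolutionOfSingularities.Theorems.SwitchingDichotomy.NoSatelliteStepTwoBasis

variable {K : Type} [Field K] [CharP K 2] {r : ℕ} (b : Fin r → K) (hB : IsTwoBasis b)

/-! ## (Σ_λ): the support kill on the λ-components -/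

omit [CharP K 2] in
/-- The bookkeeping inequality of (Σ_λ): with `D = |γ| = a + S₀ = b + S₁`, `a + b ≤ D`, (α) `S₀ ≤ a + e`, (γ) `2e ≤ D + S₁` and `e ≥ 1` force `S₁ ≥ 1`.
[folklore] -/
theorem one_le_of_constraints {a b' D e S₀ S₁ : ℕ} (he : 1 ≤ e) (hab : a + b' ≤ D) (hS₀ : D = a + S₀) (hS₁ : D = b' + S₁)
    (hα : S₀ ≤ a + e) (hγ : 2 * e ≤ D + S₁) : 1 ≤ S₁ := by
  omega

/-- **(Σ_λ) the support kill on the λ-components at a rational satellite step.** In `K⟦x, y, z_k⟧`, characteristic `2`, `K` with a finite 2-basis `b`: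
if (α) `x^(2e)·F = H(x, xy, xz)` and (γ) `F(x′y, y, wy) = A² + y^(2e)·R` with `R ∈ 𝔪^(2e)`, `e ≥ 1`, then every monomial `γ` of every `sqPart F ε`, `ε ≠ 0`,
has `Σ_{t ≠ y} γ t ≥ 1`. [folklore] -/
theorem sqPart_support_of_window {m e : ℕ} (he : 1 ≤ e) {F H A R : MvPowerSeries (Fin (m + 2)) K}
    (hα : X 0 ^ (2 * e) * F = substGenerators (R := K)
      (fun i : Fin (m + 2) => Finsupp.single i 1 + if i = 0 then 0 else 1 • Finsupp.single 0 1) (chartExp_ne_zero 0 1) H)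
    (hR : R ∈ maximalIdeal (MvPowerSeries (Fin (m + 2)) K) ^ (2 * e))
    (hγ : substGenerators (R := K)
      (fun i : Fin (m + 2) => Finsupp.single i 1 + if i = 1 then 0 else 1 • Finsupp.single 1 1) (chartExp_ne_zero 1 1) F =
        A ^ 2 + X 1 ^ (2 * e) * R) :
    ∀ ε : Fin r → Fin 2, ε ≠ 0 → ∀ γ : Fin (m + 2) →₀ ℕ, MvPowerSeries.coeff γ (sqPart b hB F ε) ≠ 0 →
      1 ≤ ∑ t ∈ Finset.univ.erase 1, γ t := by
  intro ε hε γ hγc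
  -- (α) on the component `ε`: `x^e · S_ε = (sqPart H ε)(x, xy, xz)`
  have hαε : X 0 ^ e * sqPart b hB F ε = substGenerators (R := K)
      (fun i : Fin (m + 2) => Finsupp.single i 1 + if i = 0 then 0 else 1 • Finsupp.single 0 1) (chartExp_ne_zero 0 1) (sqPart b hB H ε) := by
    rw [← (sqPart_X_pow_mul b hB F 0 e).1 ε, hα, (sqPart_substGenerators_chart b hB 0 1 H).1 ε]
  have h1 : 1 * ∑ i ∈ Finset.univ.erase 0, γ i ≤ γ 0 + e := mul_sum_le_add_of_X_pow_mul_eq_substGenerators 0 1 hαε hγc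
  -- (γ) on the component `ε ≠ 0`: `S_ε(x′y, y, wy) = y^e · sqPart R ε`
  have hγε : substGenerators (R := K)
      (fun i : Fin (m + 2) => Finsupp.single i 1 + if i = 1 then 0 else 1 • Finsupp.single 1 1) (chartExp_ne_zero 1 1) (sqPart b hB F ε) =
        X 1 ^ e * sqPart b hB R ε := by
    rw [← (sqPart_substGenerators_chart b hB 1 1 F).1 ε, hγ, sqPart_sq_add_of_ne_zero b hB _ _ hε, (sqPart_X_pow_mul b hB R 1 e).1 ε]
  have h3 := two_mul_le_degree_expSum_of_eq_X_pow_mul 1 1 hγε (fun α hα => le_degree_of_coeff_sqPart_ne_zero b hB hR hα) hγc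
  rw [NoSatelliteSupport.degree_expSum_chart] at h3
  -- bookkeeping
  have hS₀ : γ.degree = γ 0 + ∑ i ∈ Finset.univ.erase 0, γ i := by
    rw [Finsupp.degree_eq_sum, ← Finset.add_sum_erase _ _ (Finset.mem_univ (0 : Fin (m + 2)))]
  have hS₁ : γ.degree = γ 1 + ∑ i ∈ Finset.univ.erase 1, γ i := by
    rw [Finsupp.degree_eq_sum, ← Finset.add_sum_erase _ _ (Finset.mem_univ (1 : Fin (m + 2)))]
  have hab : γ 0 + γ 1 ≤ γ.degree := by
    rw [hS₁, ← Finset.add_sum_erase _ _ (Finset.mem_erase.mpr ⟨Fin.zero_ne_one, Finset.mem_univ (0 : Fin (m + 2))⟩)]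
    omega
  exact one_le_of_constraints he hab hS₀ hS₁ (by simpa using h1) (by omega)

/-! ## (N_λ): non-trivial λ-components in `(X_T)` and odd part in `(X_T)²` ⇒ not isolated -/

/-- **(N_λ).** In `K⟦X_σ⟧` (`σ = Fin c`, `K` of characteristic `2` with a finite 2-basis `b`): if every ODD monomial of `f` has `T`-degree `≥ 2` and every
monomial of every `sqPart f ε`, `ε ≠ 0`, has `T`-degree `≥ 1`, for a set of letters `T` with `#T < c`, then the `2`-radicand `K⟦X⟧[U]/(U² − f)` is NOT isolated:
`f − (sqPart f 0)² = ∑_{ε ≠ 0} λ^ε (sqPart f ε)² + oddPart f ∈ (X_T)²` and (CD0). [cite: Matsumura1987, Thm. 14.2] [folklore] -/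
theorem not_hasIsolatedSingularity_of_twoBasis_support {c : ℕ} (T : Finset (Fin c)) (hT : T.card < c) (f : MvPowerSeries (Fin c) K)
    (hodd : ∀ m : Fin c →₀ ℕ, (∃ i, Odd (m i)) → MvPowerSeries.coeff m f ≠ 0 → 2 ≤ ∑ t ∈ T, m t)
    (hsq : ∀ ε : Fin r → Fin 2, ε ≠ 0 → ∀ m : Fin c →₀ ℕ, MvPowerSeries.coeff m (sqPart b hB f ε) ≠ 0 → 1 ≤ ∑ t ∈ T, m t) :
    ¬ HasIsolatedSingularity (RadicandRing (MvPowerSeries (Fin c) K) 2 f) := by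
  classical
  haveI : Fact (Nat.Prime 2) := ⟨Nat.prime_two⟩
  haveI : IsRegularLocalRing (MvPowerSeries (Fin c) K) := isRegularLocalRing_mvPowerSeries K (Fin c)
  haveI : CharP (MvPowerSeries (Fin c) K) 2 := charP_of_injective_algebraMap (C_injective (σ := Fin c) (R := K)) 2
  set I : Ideal (MvPowerSeries (Fin c) K) := Ideal.span ((fun s : Fin c => (X s : MvPowerSeries (Fin c) K)) '' (T : Set (Fin c))) with hI
  -- the odd part lies in `I²`
  have hO : oddPart b hB f ∈ I ^ 2 := by
    refine PowerSeriesParity.mem_pow_span_X_of_le_sum T 2 _ fun m hm => ?_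
    have hme : ¬ ∀ i, Even (m i) := fun h => hm (coeff_oddPart_of_even b hB f h)
    refine hodd m ?_ (by rwa [coeff_oddPart_of_not_even b hB f hme] at hm)
    by_contra hall
    push Not at hall
    exact hme fun i => Nat.not_odd_iff_even.mp (hall i)
  -- the non-trivial square parts lie in `I`, so their `λ^ε`-multiples of squares lie in `I²`
  have hS : ∀ ε : Fin r → Fin 2, ε ≠ 0 → MvPowerSeries.C (lamPow b ε) * sqPart b hB f ε ^ 2 ∈ I ^ 2 := by
    intro ε hε
    have h1 : sqPart b hB f ε ∈ I ^ 1 := PowerSeriesParity.mem_pow_span_X_of_le_sum T 1 _ (hsq ε hε)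
    rw [pow_one] at h1
    rw [pow_two, pow_two]
    exact Ideal.mul_mem_left _ _ (Ideal.mul_mem_mul h1 h1)
  -- `f − (sqPart f 0)² ∈ I²`
  have hsplit : (∑ ε, MvPowerSeries.C (lamPow b ε) * sqPart b hB f ε ^ 2) =
      sqPart b hB f 0 ^ 2 + ∑ ε ∈ Finset.univ.erase 0, MvPowerSeries.C (lamPow b ε) * sqPart b hB f ε ^ 2 := by
    rw [← Finset.add_sum_erase _ _ (Finset.mem_univ (0 : Fin r → Fin 2)), lamPow_zero, map_one, one_mul]
  have hf' : f = sqPart b hB f 0 ^ 2 + (∑ ε ∈ Finset.univ.erase 0, MvPowerSeries.C (lamPow b ε) * sqPart b hB f ε ^ 2) + oddPart b hB f :=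
    (eq_sum_sqPart_add_oddPart b hB f).trans (by rw [hsplit])
  have hf : f - sqPart b hB f 0 ^ 2 = (∑ ε ∈ Finset.univ.erase 0, MvPowerSeries.C (lamPow b ε) * sqPart b hB f ε ^ 2) + oddPart b hB f := by
    linear_combination hf'
  have hmem : f - sqPart b hB f 0 ^ 2 ∈ I ^ 2 := by
    rw [hf]
    exact Ideal.add_mem _ (Ideal.sum_mem _ fun ε hε => hS ε (Finset.ne_of_mem_erase hε)) hO
  -- (CD0) with the `#T` generators `X_t ∈ 𝔪`
  have hspan : I = Ideal.span ((T.image fun s : Fin c => (X s : MvPowerSeries (Fin c) K) : Finset (MvPowerSeries (Fin c) K)) :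
      Set (MvPowerSeries (Fin c) K)) := by
    rw [hI, Finset.coe_image]
  rw [hspan] at hmem
  refine NoSatelliteStep.not_hasIsolatedSingularity_of_sub_pow_mem_sq_span_abstract 2 f (sqPart b hB f 0) _ (fun t ht => ?_) hmem
    (lt_of_le_of_lt Finset.card_image_le hT) ?_
  · obtain ⟨s, -, rfl⟩ := Finset.mem_image.mp ht
    exact X_mem_maximalIdeal K (Fin c) s
  · rw [ringKrullDim_mvPowerSeries, Nat.card_eq_fintype_card, Fintype.card_fin]

/-! ## The package for the one-window theorem -/

omit [CharP K 2] in
/-- **Undo the residue isomorphism** on a reading `ρ_*(Φ) = A² + X_1^k · R`, `R ∈ 𝔪^k`: `Φ = A₀² + X_1^k · R₀` with `R₀ ∈ 𝔪^k` over `K`. [folklore] -/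
theorem eq_sq_add_of_map_ringEquiv {m : ℕ} {K' : Type} [Field K'] (ρ : K ≃+* K') {k : ℕ} {Φ : MvPowerSeries (Fin (m + 2)) K}
    {A R : MvPowerSeries (Fin (m + 2)) K'} (hR : R ∈ maximalIdeal (MvPowerSeries (Fin (m + 2)) K') ^ k)
    (h : MvPowerSeries.map (ρ : K →+* K') Φ = A ^ 2 + X 1 ^ k * R) :
    ∃ A₀ R₀ : MvPowerSeries (Fin (m + 2)) K, R₀ ∈ maximalIdeal (MvPowerSeries (Fin (m + 2)) K) ^ k ∧ Φ = A₀ ^ 2 + X 1 ^ k * R₀ := by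
  have hback : MvPowerSeries.map (ρ.symm : K' →+* K) (MvPowerSeries.map (ρ : K →+* K') Φ) = Φ := by
    ext d; rw [coeff_map, coeff_map]; exact ρ.symm_apply_apply _
  refine ⟨MvPowerSeries.map (ρ.symm : K' →+* K) A, MvPowerSeries.map (ρ.symm : K' →+* K) R, ?_, ?_⟩
  · rw [Jets.mem_maximalIdeal_pow_iff] at hR ⊢
    intro d hd
    rw [coeff_map, hR d hd, map_zero]
  · rw [← hback, h, map_add, map_pow, map_mul, map_pow, map_X]

/-- **(Σ)+(Σ_λ)+(N_λ) — the package replacing the perfect-field stages (Σ)+(N) of Lemma S.** In `K⟦x, y, z_k⟧` (`σ = Fin (m+2)`, `x ↔ 0`, `y ↔ 1`), `K` of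
characteristic `2` with a finite 2-basis `b`, `ρ : K ≃+* K'` the residue isomorphism of the RATIONAL satellite step: (α) `x^(2e)·F = H(x, xy, xz)`,
(β) `F − G² ∈ 𝔪^(2e)`, (γ) `ρ_*(F(x′y, y, wy)) = A² + y^(2e)·R`, `R ∈ 𝔪^(2e)`, `e ≥ 2` ⟹ the `2`-radicand of `F` over `K⟦x, y, z_k⟧` is NOT isolated.
[cite: Matsumura1987, Thm. 14.2] [folklore] -/
theorem not_hasIsolatedSingularity_of_window_twoBasis {m e r : ℕ} (he : 2 ≤ e) (b : Fin r → K) (hB : IsTwoBasis b) {K' : Type} [Field K'] [CharP K' 2] (ρ : K ≃+* K')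
    {F G H : MvPowerSeries (Fin (m + 2)) K} {A R : MvPowerSeries (Fin (m + 2)) K'}
    (hα : X 0 ^ (2 * e) * F = substGenerators (R := K)
      (fun i : Fin (m + 2) => Finsupp.single i 1 + if i = 0 then 0 else 1 • Finsupp.single 0 1) (chartExp_ne_zero 0 1) H)
    (hβ : F - G ^ 2 ∈ maximalIdeal (MvPowerSeries (Fin (m + 2)) K) ^ (2 * e))
    (hR : R ∈ maximalIdeal (MvPowerSeries (Fin (m + 2)) K') ^ (2 * e))
    (hγ : MvPowerSeries.map (ρ : K →+* K') (substGenerators (R := K)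
      (fun i : Fin (m + 2) => Finsupp.single i 1 + if i = 1 then 0 else 1 • Finsupp.single 1 1) (chartExp_ne_zero 1 1) F) =
        A ^ 2 + X 1 ^ (2 * e) * R) :
    ¬ HasIsolatedSingularity (RadicandRing (MvPowerSeries (Fin (m + 2)) K) 2 F) := by
  classical
  have hodd := NoSatelliteSupport.odd_support_of_window (by omega : 4 ≤ 2 * e) (ρ : K →+* K') hα hβ hR hγ
  obtain ⟨A₀, R₀, hR₀, hγ₀⟩ := eq_sq_add_of_map_ringEquiv ρ hR hγ
  have hsq := sqPart_support_of_window b hB (by omega : 1 ≤ e) hα hR₀ hγ₀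
  exact not_hasIsolatedSingularity_of_twoBasis_support b hB (Finset.univ.erase 1)
    (by rw [Finset.card_erase_of_mem (Finset.mem_univ _), Finset.card_univ, Fintype.card_fin]; omega) F hodd hsq

end Summit.ResolutionOfSingularities.ResolutionOfSingularities.Theorems.SwitchingDichotomy.NoSatelliteStepTwoBasis

end
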